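import Literature.MathematicalPhysics.QuantumLattice.DWaveSourceThermalGibbsTorusLimit
import Literature.MathematicalPhysics.QuantumLattice.HubbardTTPrimeThermalAnnexOfBoxWords
import HarnessLib

/-!
# The `T > 0` pairing-RESPONSE FLOOR of the pair-sourced `t–t'` Hubbard model:
# `(p(μ)-floor − e_src-cap − (log 4)/β)/(2h) ≤ Re ω(P₀^d)` for every torus-limit thermal state

Family `hubbard` (topic `MathematicalPhysics/QuantumLattice`); stage S2 of the Hubbard material oracle («certifier
families … `T > 0`», D-0096 (iii)): the `T`-axis of the pairing-RESPONSE annex of the certified box words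
(`Certificates/HubbardSquare_*_pinning_responseFloors_*`: at `T = 0` every translation-invariant density-`n`
minimiser of `E_h(t',U) = e_Φ − h·2Re P₀^d` has `Re ω(P₀^d) ≥ (floor − cap)/(2h)`, Griffiths' convexity argument).
Companion of `DWaveSourceThermalGibbsTorusLimit` (the thermal object: torus limits `ω` of the grand-canonical Gibbs
states `e^{−βA_L}/tr e^{−βA_L}` of the pair-sourced tori `A_L(t',U,μ,h) = dWaveSourceTorusTT' L t' U μ h`, and their
energy–entropy window `e_src ≤ e_Ψ(ω) ≤ e_src + (log 4)/β`).

**The floor** (`IsTorusLimitOfMixture.div_le_re_expect_localPairAt_of_sourcedGibbs`): for such an `ω` at `β > 0`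
(`U ≥ 0`, `h > 0`, any `t'`, `μ`), a certified floor `lo ≤ p(1,t',U,μ)` on the Legendre object
`gcEnergyDensityTT' 1 t' U μ = inf_n (e(1,t',U,n) − μn)` of the source-FREE model and a certified cap
`e_src(t',U,μ,h) ≤ C` give

  `(lo − C − (log 4)/β)/(2h) ≤ Re ω(P₀^d)`,

because `e_Ψ(ω) = e_Φ(ω) − μρ(ω) − h·2Re ω(P₀^d) ≤ e_src + (log 4)/β` (the window) and
`lo ≤ p(μ) ≤ e_Φ(ω) − μρ(ω)` for the translation-invariant `ω` (`gcEnergyDensityTT'_le_meanEnergy_hubbardTTPrimeMu`).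
Feeders: `lo` from ONE every-density tangent sheet with slope `μ` (`le_gcEnergyDensityTT'`) or from TWO sheets whose
slopes bracket `μ` (`le_gcEnergyDensityTT'_of_two_sheets`: the convex combination with slope `μ`), and on `(t′,U)` CELLS the
bilinear corner rule `gcEnergyDensityTT'_rect_ge`, on `(t′,U,μ)` BOXES the trilinear rule `gcEnergyDensityTT'_box₃_ge` (joint
concavity of `p`, `gcEnergyDensityTT'_ge_sum_lowerBounds`); `C` from any
translation-invariant trial state (`dWaveSourceEnergyDensityTT'_le_of_exists_isTranslationInvariant` — the shape in
which the `4 × 3` cluster nodes of the `T = 0` words enter, via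
`exists_gcClass_sourced_le_of_clusterCapTT'`). Temperature CELLS `β ≥ β₀ > 0` (`…_of_le_…`) and the decimal form
(`…_decimal_…`, `log 4/β₀ ≤ 1.3863/β₀` = `log_four_div_le_decimal` of the thermal ENERGY annex `HubbardTTPrimeThermalAnnexOfBoxWords`).

Reading: a `T = 0` grand-canonical response word (one cluster node at `μ`, one `μ`-floor) loses `(log 4)·T/(2h)` at
temperature `T` — `0.858·T` at `h = √2·4/7` (`+0.086` at `T = t/10`, `+0.214` at `T = t/4`): cuprate-box words of
size `≈ 0.3` stay positive up to `T ≈ t/3`. Keyed by the CHEMICAL POTENTIAL `μ` (the density of a thermal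
grand-canonical state is not certified here). Consistent with the barrier `HohenbergMerminWagnerPairingQuasiAverage`
(the thermal sourced response tends to `0` as `h → 0`, uniformly in the volume): LARGE-FIELD floors, no `h → 0`
content. WHAT THIS IS NOT: an order parameter, a phase word, a `T_c` statement, a KMS statement, a canonical
(fixed-density) statement.

## Mathlib / tree search

`lean search 'thermal.*response.*floor|sourcedGibbs.*localPairAt'`: none before this file (2026-08-27); the `T = 0`
reader is `Summit…Observables.TISourcedClusterTrialRowsTTPrime.minimiser_response_floor_of_two_clusterNodesTT'_4x3`.
REUSED: `IsTorusLimitOfMixture.meanEnergy_sourced_le_dWaveSourceEnergyDensityTT'_add_log_four_div_of_sourcedGibbs`,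
`meanEnergy_hubbardTTPrimeSourced`, `meanEnergy_pairSourceInteraction_dWave_eq`, `meanEnergy_hubbardTTPrimeMu`,
`gcEnergyDensityTT'_le_meanEnergy_hubbardTTPrimeMu`, `le_gcEnergyDensityTT'`,
`dWaveSourceEnergyDensityTT'_le_meanEnergy_sourced`, `log_four_div_le_decimal` (`HubbardTTPrimeThermalAnnexOfBoxWords`).

## References

* R. B. Griffiths, Phys. Rev. 152 (1966) 240, §II (order parameters as field derivatives; convexity bounds).
  [cite: Griffiths1966, §II]
* R. B. Israel, *Convexity in the Theory of Lattice Gases* (1979), Lemma II.3.1. [cite: Israel1979, Lemma II.3.1]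
* T. Koma, H. Tasaki, J. Stat. Phys. 76 (1994) 745, §1. [cite: KomaTasaki1994, §1]
* D. Ruelle, *Statistical Mechanics: Rigorous Results* (1969), §3.4. [cite: Ruelle1969, §3.4]
-/

noncomputable section

namespace Literature.MathematicalPhysics.QuantumLattice

open Matrix Finset HubbardWave0 Literature.Probability.LatticeModels ThermodynamicLimit
open _root_.Filter
open scoped _root_.Topology ComplexOrder BigOperators

namespace InfVolFermionState

variable (tp U μ h : ℝ)

/-! ### §1 Floors on the Legendre object from every-density sheets -/

/-- **Two every-density SHEETS whose slopes bracket `μ` give a floor on the Legendre object**: from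
`Aᵢ + Bᵢ·m ≤ e(t,t',U,m)` (`i = 1,2`, all `0 < m < 2`, `U ≥ 0`) and `B₁ ≤ μ ≤ B₂`, `B₁ < B₂`,
`((B₂ − μ)A₁ + (μ − B₁)A₂)/(B₂ − B₁) ≤ p(t,t',U,μ)` (the convex combination of the two sheets with slope
exactly `μ`). [cite: Ruelle1969, §3.4] -/
theorem _root_.Literature.MathematicalPhysics.QuantumLattice.ThermodynamicLimit.le_gcEnergyDensityTT'_of_two_sheets
    {t t' U μ A₁ B₁ A₂ B₂ : ℝ} (hU : 0 ≤ U)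
    (h₁ : ∀ m : ℝ, 0 < m → m < 2 → A₁ + B₁ * m ≤ energyDensityTT' t t' U m)
    (h₂ : ∀ m : ℝ, 0 < m → m < 2 → A₂ + B₂ * m ≤ energyDensityTT' t t' U m)
    (hB₁ : B₁ ≤ μ) (hB₂ : μ ≤ B₂) (hlt : B₁ < B₂) :
    ((B₂ - μ) * A₁ + (μ - B₁) * A₂) / (B₂ - B₁) ≤ gcEnergyDensityTT' t t' U μ := by
  refine le_gcEnergyDensityTT'_of_Ioo t t' hU fun m hm0 hm2 => ?_
  have e1 := mul_le_mul_of_nonneg_left (h₁ m hm0 hm2) (sub_nonneg.2 hB₂)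
  have e2 := mul_le_mul_of_nonneg_left (h₂ m hm0 hm2) (sub_nonneg.2 hB₁)
  have hpos : 0 < B₂ - B₁ := sub_pos.2 hlt
  have key : (B₂ - μ) * A₁ + (μ - B₁) * A₂ ≤ (energyDensityTT' t t' U m - μ * m) * (B₂ - B₁) := by
    nlinarith [e1, e2, hm0.le]
  rw [div_add' _ _ _ hpos.ne', div_le_iff₀ hpos]
  nlinarith [key]

/-- **One every-density SHEET with slope ABOVE `μ`**: from `A + B·m ≤ e(t,t',U,m)` (all `0 < m < 2`, `U ≥ 0`) and `μ ≤ B`,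
`A ≤ p(t,t',U,μ)` (the worst density is `m = 0`). [cite: Ruelle1969, §3.4] -/
theorem _root_.Literature.MathematicalPhysics.QuantumLattice.ThermodynamicLimit.le_gcEnergyDensityTT'_of_sheet_of_le
    {t t' U μ A B : ℝ} (hU : 0 ≤ U) (h : ∀ m : ℝ, 0 < m → m < 2 → A + B * m ≤ energyDensityTT' t t' U m)
    (hB : μ ≤ B) : A ≤ gcEnergyDensityTT' t t' U μ :=
  le_gcEnergyDensityTT'_of_Ioo t t' hU fun m hm0 hm2 => by
    have h1 := h m hm0 hm2
    nlinarith [mul_le_mul_of_nonneg_right hB hm0.le]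

/-- **One every-density SHEET with slope BELOW `μ`**: from `A + B·m ≤ e(t,t',U,m)` (all `0 < m < 2`, `U ≥ 0`) and `B ≤ μ`,
`A + 2(B − μ) ≤ p(t,t',U,μ)` (the worst density is `m → 2`). [cite: Ruelle1969, §3.4] -/
theorem _root_.Literature.MathematicalPhysics.QuantumLattice.ThermodynamicLimit.le_gcEnergyDensityTT'_of_sheet_of_ge
    {t t' U μ A B : ℝ} (hU : 0 ≤ U) (h : ∀ m : ℝ, 0 < m → m < 2 → A + B * m ≤ energyDensityTT' t t' U m)
    (hB : B ≤ μ) : A + 2 * (B - μ) ≤ gcEnergyDensityTT' t t' U μ :=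
  le_gcEnergyDensityTT'_of_Ioo t t' hU fun m hm0 hm2 => by
    have h1 := h m hm0 hm2
    nlinarith [mul_le_mul_of_nonneg_left hm2.le (sub_nonneg.2 hB)]

/-- **Bilinear corner rule for the Legendre object on a `(t', U)` rectangle** (fixed `t`, `μ`): certified floors
`cᵢⱼ ≤ p(t, sᵢ, Uⱼ, μ)` at the four corners of `[s₁,s₂] × [U₁,U₂]` (`U₁ ≥ 0`) give, at every point of the rectangle,
the bilinear interpolant as a floor (joint concavity of `p` in `(t', U, μ)`, `gcEnergyDensityTT'_ge_sum_lowerBounds`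
with the four bilinear weights). [cite: Israel1979, Thm. I.3.4] -/
theorem _root_.Literature.MathematicalPhysics.QuantumLattice.ThermodynamicLimit.gcEnergyDensityTT'_rect_ge {t s₁ s₂ U₁ U₂ μ c₁₁ c₁₂ c₂₁ c₂₂ s U : ℝ}
    (hU₀ : 0 ≤ U₁) (hs : s₁ < s₂) (hU : U₁ < U₂)
    (h₁₁ : c₁₁ ≤ gcEnergyDensityTT' t s₁ U₁ μ) (h₁₂ : c₁₂ ≤ gcEnergyDensityTT' t s₁ U₂ μ)
    (h₂₁ : c₂₁ ≤ gcEnergyDensityTT' t s₂ U₁ μ) (h₂₂ : c₂₂ ≤ gcEnergyDensityTT' t s₂ U₂ μ)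
    (hs₁ : s₁ ≤ s) (hs₂ : s ≤ s₂) (hU₁ : U₁ ≤ U) (hU₂ : U ≤ U₂) :
    ((s₂ - s) * ((U₂ - U) * c₁₁ + (U - U₁) * c₁₂) + (s - s₁) * ((U₂ - U) * c₂₁ + (U - U₁) * c₂₂)) /
        ((s₂ - s₁) * (U₂ - U₁)) ≤ gcEnergyDensityTT' t s U μ := by
  have hD : 0 < (s₂ - s₁) * (U₂ - U₁) := mul_pos (sub_pos.2 hs) (sub_pos.2 hU)
  set D := (s₂ - s₁) * (U₂ - U₁) with hDdef
  set w : Fin 4 → ℝ := ![(s₂ - s) * (U₂ - U) / D, (s₂ - s) * (U - U₁) / D, (s - s₁) * (U₂ - U) / D,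
    (s - s₁) * (U - U₁) / D] with hw
  set tp : Fin 4 → ℝ := ![s₁, s₁, s₂, s₂] with htp
  set UU : Fin 4 → ℝ := ![U₁, U₂, U₁, U₂] with hUU
  set c : Fin 4 → ℝ := ![c₁₁, c₁₂, c₂₁, c₂₂] with hc
  have key := gcEnergyDensityTT'_ge_sum_lowerBounds t (Finset.univ : Finset (Fin 4)) w tp UU (fun _ => μ) c
    (fun i _ => by
      fin_cases i <;> simp [hw] <;> first
        | exact div_nonneg (mul_nonneg (by linarith) (by linarith)) hD.le)
    (by simp [hw, Fin.sum_univ_four]; field_simp; ring)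
    (fun i _ => by fin_cases i <;> simp [hUU] <;> linarith)
    (fun i _ => by fin_cases i <;> simp [hc, htp, hUU] <;> assumption)
  have h1 : ∑ i : Fin 4, w i * tp i = s := by simp [hw, htp, Fin.sum_univ_four]; field_simp; ring
  have h2 : ∑ i : Fin 4, w i * UU i = U := by simp [hw, hUU, Fin.sum_univ_four]; field_simp; ring
  have h3 : ∑ i : Fin 4, w i * μ = μ := by
    rw [← Finset.sum_mul]; simp [hw, Fin.sum_univ_four]; field_simp; ring
  have h4 : ∑ i : Fin 4, w i * c i =
      ((s₂ - s) * ((U₂ - U) * c₁₁ + (U - U₁) * c₁₂) + (s - s₁) * ((U₂ - U) * c₂₁ + (U - U₁) * c₂₂)) / D := by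
    simp [hw, hc, Fin.sum_univ_four]; field_simp; ring
  rw [h1, h2, h3, h4] at key
  exact key

/-- **Trilinear corner rule for the Legendre object on a `(t', U, μ)` box** (fixed `t`): certified floors
`cᵢⱼₖ ≤ p(t, sᵢ, Uⱼ, μₖ)` at the eight corners of `[s₁,s₂] × [U₁,U₂] × [μ₁,μ₂]` (`U₁ ≥ 0`) give, at every point of the
box, the trilinear interpolant as a floor (joint concavity of `p` in `(t', U, μ)`, `gcEnergyDensityTT'_ge_sum_lowerBounds`
with the eight trilinear weights). [cite: Israel1979, Thm. I.3.4] -/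
theorem _root_.Literature.MathematicalPhysics.QuantumLattice.ThermodynamicLimit.gcEnergyDensityTT'_box₃_ge
    {t s₁ s₂ U₁ U₂ μ₁ μ₂ c₁₁₁ c₁₁₂ c₁₂₁ c₁₂₂ c₂₁₁ c₂₁₂ c₂₂₁ c₂₂₂ s U μ : ℝ}
    (hU₀ : 0 ≤ U₁) (hs : s₁ < s₂) (hU : U₁ < U₂) (hμ : μ₁ < μ₂)
    (h₁₁₁ : c₁₁₁ ≤ gcEnergyDensityTT' t s₁ U₁ μ₁) (h₁₁₂ : c₁₁₂ ≤ gcEnergyDensityTT' t s₁ U₁ μ₂)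
    (h₁₂₁ : c₁₂₁ ≤ gcEnergyDensityTT' t s₁ U₂ μ₁) (h₁₂₂ : c₁₂₂ ≤ gcEnergyDensityTT' t s₁ U₂ μ₂)
    (h₂₁₁ : c₂₁₁ ≤ gcEnergyDensityTT' t s₂ U₁ μ₁) (h₂₁₂ : c₂₁₂ ≤ gcEnergyDensityTT' t s₂ U₁ μ₂)
    (h₂₂₁ : c₂₂₁ ≤ gcEnergyDensityTT' t s₂ U₂ μ₁) (h₂₂₂ : c₂₂₂ ≤ gcEnergyDensityTT' t s₂ U₂ μ₂)
    (hs₁ : s₁ ≤ s) (hs₂ : s ≤ s₂) (hU₁ : U₁ ≤ U) (hU₂ : U ≤ U₂) (hμ₁ : μ₁ ≤ μ) (hμ₂ : μ ≤ μ₂) :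
    ((s₂ - s) * ((U₂ - U) * ((μ₂ - μ) * c₁₁₁ + (μ - μ₁) * c₁₁₂) + (U - U₁) * ((μ₂ - μ) * c₁₂₁ + (μ - μ₁) * c₁₂₂)) +
      (s - s₁) * ((U₂ - U) * ((μ₂ - μ) * c₂₁₁ + (μ - μ₁) * c₂₁₂) + (U - U₁) * ((μ₂ - μ) * c₂₂₁ + (μ - μ₁) * c₂₂₂))) /
        ((s₂ - s₁) * (U₂ - U₁) * (μ₂ - μ₁)) ≤ gcEnergyDensityTT' t s U μ := by
  have hD : 0 < (s₂ - s₁) * (U₂ - U₁) * (μ₂ - μ₁) := mul_pos (mul_pos (sub_pos.2 hs) (sub_pos.2 hU)) (sub_pos.2 hμ)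
  set D := (s₂ - s₁) * (U₂ - U₁) * (μ₂ - μ₁) with hDdef
  set w : Fin 8 → ℝ := ![(s₂ - s) * (U₂ - U) * (μ₂ - μ) / D, (s₂ - s) * (U₂ - U) * (μ - μ₁) / D,
    (s₂ - s) * (U - U₁) * (μ₂ - μ) / D, (s₂ - s) * (U - U₁) * (μ - μ₁) / D,
    (s - s₁) * (U₂ - U) * (μ₂ - μ) / D, (s - s₁) * (U₂ - U) * (μ - μ₁) / D,
    (s - s₁) * (U - U₁) * (μ₂ - μ) / D, (s - s₁) * (U - U₁) * (μ - μ₁) / D] with hw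
  set tp : Fin 8 → ℝ := ![s₁, s₁, s₁, s₁, s₂, s₂, s₂, s₂] with htp
  set UU : Fin 8 → ℝ := ![U₁, U₁, U₂, U₂, U₁, U₁, U₂, U₂] with hUU
  set MM : Fin 8 → ℝ := ![μ₁, μ₂, μ₁, μ₂, μ₁, μ₂, μ₁, μ₂] with hMM
  set c : Fin 8 → ℝ := ![c₁₁₁, c₁₁₂, c₁₂₁, c₁₂₂, c₂₁₁, c₂₁₂, c₂₂₁, c₂₂₂] with hc
  have key := gcEnergyDensityTT'_ge_sum_lowerBounds t (Finset.univ : Finset (Fin 8)) w tp UU MM c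
    (fun i _ => by
      fin_cases i <;> simp [hw] <;>
        exact div_nonneg (mul_nonneg (mul_nonneg (by linarith) (by linarith)) (by linarith)) hD.le)
    (by simp [hw, Fin.sum_univ_eight]; field_simp; ring)
    (fun i _ => by fin_cases i <;> simp [hUU] <;> linarith)
    (fun i _ => by fin_cases i <;> simp [hc, htp, hUU, hMM] <;> assumption)
  have h1 : ∑ i : Fin 8, w i * tp i = s := by simp [hw, htp, Fin.sum_univ_eight]; field_simp; ring
  have h2 : ∑ i : Fin 8, w i * UU i = U := by simp [hw, hUU, Fin.sum_univ_eight]; field_simp; ring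
  have h3 : ∑ i : Fin 8, w i * MM i = μ := by simp [hw, hMM, Fin.sum_univ_eight]; field_simp; ring
  have h4 : ∑ i : Fin 8, w i * c i =
      ((s₂ - s) * ((U₂ - U) * ((μ₂ - μ) * c₁₁₁ + (μ - μ₁) * c₁₁₂) + (U - U₁) * ((μ₂ - μ) * c₁₂₁ + (μ - μ₁) * c₁₂₂)) +
        (s - s₁) * ((U₂ - U) * ((μ₂ - μ) * c₂₁₁ + (μ - μ₁) * c₂₁₂) + (U - U₁) * ((μ₂ - μ) * c₂₂₁ + (μ - μ₁) * c₂₂₂))) / D := by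
    simp [hw, hc, Fin.sum_univ_eight]; field_simp; ring
  rw [h1, h2, h3, h4] at key
  exact key

/-! ### §2 The thermal response floor -/

/-- **THE THERMAL PAIRING-RESPONSE FLOOR.** Let `ω` be a torus limit of the grand-canonical Gibbs states of
the pair-sourced tori `A_L(t',U,μ,h)` at `β > 0` (`U ≥ 0`, `h > 0`). From a floor `lo ≤ p(1,t',U,μ)` on the
Legendre object of the source-FREE model and a cap `e_src(t',U,μ,h) ≤ C` on the sourced grand-canonical
energy density: `(lo − C − (log 4)/β)/(2h) ≤ Re ω(P₀^d)`
(`e_Ψ(ω) = e_Φ(ω) − μρ(ω) − h·2Re ω(P₀^d) ≤ e_src + (log 4)/β ≤ C + (log 4)/β` and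
`lo ≤ p(μ) ≤ e_Φ(ω) − μρ(ω)`). A LARGE-FIELD response floor at temperature `1/β`, keyed by the chemical
potential; not an order parameter, no phase word. [cite: Griffiths1966, §II] [cite: Israel1979, Lemma II.3.1] -/
theorem IsTorusLimitOfMixture.div_le_re_expect_localPairAt_of_sourcedGibbs (hU : 0 ≤ U) (hh : 0 < h)
    {β : ℝ} (hβ : 0 < β) {lo C : ℝ} (hlo : lo ≤ gcEnergyDensityTT' 1 tp U μ)
    (hC : dWaveSourceEnergyDensityTT' tp U μ h ≤ C) {ω : InfVolFermionState 2} {Ls : ℕ → ℕ}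
    (hω : ω.IsTorusLimitOfMixture sourcedGibbsCount (fun L => sourcedGibbsWeightTT' β tp U μ h L)
      (fun L => sourcedGibbsVectorTT' tp U μ h L) Ls)
    (hLs : Tendsto Ls atTop atTop) :
    (lo - C - Real.log 4 / β) / (2 * h) ≤
      (ω.expect (pairRegion (insert 0 unitSteps) 0) (localPairAt (insert 0 unitSteps) dWaveFormFactor 0)).re := by
  have hcap := hω.meanEnergy_sourced_le_dWaveSourceEnergyDensityTT'_add_log_four_div_of_sourcedGibbs tp U μ h hβ hLs
  have hgc := gcEnergyDensityTT'_le_meanEnergy_hubbardTTPrimeMu 1 tp hU μ hω.isTranslationInvariant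
  rw [meanEnergy_hubbardTTPrimeMu] at hgc
  rw [meanEnergy_hubbardTTPrimeSourced, meanEnergy_pairSourceInteraction_dWave_eq] at hcap
  rw [div_le_iff₀ (by positivity)]
  linarith

/-- **Temperature CELL `T ≤ 1/β₀`**: for every `β ≥ β₀ > 0` the floor holds with the uniform entropy price
`(log 4)/β₀`: `(lo − C − (log 4)/β₀)/(2h) ≤ Re ω(P₀^d)`. [cite: Griffiths1966, §II] [cite: Israel1979, Lemma II.3.1] -/
theorem IsTorusLimitOfMixture.div_le_re_expect_localPairAt_of_le_of_sourcedGibbs (hU : 0 ≤ U) (hh : 0 < h)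
    {β₀ β : ℝ} (hβ₀ : 0 < β₀) (hββ : β₀ ≤ β) {lo C : ℝ} (hlo : lo ≤ gcEnergyDensityTT' 1 tp U μ)
    (hC : dWaveSourceEnergyDensityTT' tp U μ h ≤ C) {ω : InfVolFermionState 2} {Ls : ℕ → ℕ}
    (hω : ω.IsTorusLimitOfMixture sourcedGibbsCount (fun L => sourcedGibbsWeightTT' β tp U μ h L)
      (fun L => sourcedGibbsVectorTT' tp U μ h L) Ls)
    (hLs : Tendsto Ls atTop atTop) :
    (lo - C - Real.log 4 / β₀) / (2 * h) ≤
      (ω.expect (pairRegion (insert 0 unitSteps) 0) (localPairAt (insert 0 unitSteps) dWaveFormFactor 0)).re := by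
  have hβ : 0 < β := hβ₀.trans_le hββ
  have h1 := hω.div_le_re_expect_localPairAt_of_sourcedGibbs tp U μ h hU hh hβ hlo hC hLs
  have hlog : Real.log 4 / β ≤ Real.log 4 / β₀ :=
    div_le_div_of_nonneg_left (Real.log_nonneg (by norm_num)) hβ₀ hββ
  refine le_trans ?_ h1
  exact div_le_div_of_nonneg_right (by linarith) (by positivity)

/-- **Decimal temperature cell**: for every `β ≥ β₀ > 0`, `(lo − C − 1.3863/β₀)/(2h) ≤ Re ω(P₀^d)` — the shape
read by the certificate words (rational `lo, C, β₀, h`). [cite: Griffiths1966, §II] [cite: Israel1979, Lemma II.3.1] -/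
theorem IsTorusLimitOfMixture.div_le_re_expect_localPairAt_decimal_of_sourcedGibbs (hU : 0 ≤ U) (hh : 0 < h)
    {β₀ β : ℝ} (hβ₀ : 0 < β₀) (hββ : β₀ ≤ β) {lo C : ℝ} (hlo : lo ≤ gcEnergyDensityTT' 1 tp U μ)
    (hC : dWaveSourceEnergyDensityTT' tp U μ h ≤ C) {ω : InfVolFermionState 2} {Ls : ℕ → ℕ}
    (hω : ω.IsTorusLimitOfMixture sourcedGibbsCount (fun L => sourcedGibbsWeightTT' β tp U μ h L)
      (fun L => sourcedGibbsVectorTT' tp U μ h L) Ls)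
    (hLs : Tendsto Ls atTop atTop) :
    (lo - C - 1.3863 / β₀) / (2 * h) ≤
      (ω.expect (pairRegion (insert 0 unitSteps) 0) (localPairAt (insert 0 unitSteps) dWaveFormFactor 0)).re := by
  have h1 := hω.div_le_re_expect_localPairAt_of_le_of_sourcedGibbs tp U μ h hU hh hβ₀ hββ hlo hC hLs
  have hlog : Real.log 4 / β₀ ≤ 1.3863 / β₀ := log_four_div_le_decimal hβ₀
  refine le_trans ?_ h1
  exact div_le_div_of_nonneg_right (by linarith) (by positivity)

/-- **Cap from a translation-invariant trial state** (the shape in which cluster certificates enter): if some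
translation-invariant `σ` has `e_Ψ(σ) ≤ C` then `e_src ≤ C`. [cite: BratteliKishimotoRobinson1978, Thm. 2] -/
theorem _root_.Literature.MathematicalPhysics.QuantumLattice.dWaveSourceEnergyDensityTT'_le_of_exists_isTranslationInvariant
    {C : ℝ} (hσ : ∃ σ : InfVolFermionState 2, σ.IsTranslationInvariant ∧
      σ.meanEnergy (hubbardTTPrimeSourcedInteraction 1 tp U μ dWaveFormFactor h) 1 ≤ C) :
    dWaveSourceEnergyDensityTT' tp U μ h ≤ C := by
  obtain ⟨σ, hσ, hC⟩ := hσ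
  exact (dWaveSourceEnergyDensityTT'_le_meanEnergy_sourced tp U μ h hσ).trans hC

end InfVolFermionState

end Literature.MathematicalPhysics.QuantumLattice

end
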